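import Summits.AtomisticToContinuum.FouriersLaw.Cruxes.PositiveMemory.Lines.Sketch
import Summits.AtomisticToContinuum.FouriersLaw.Theorems.HonestZwanzigPositiveMemoryFloorOfBackflowFloor

/-! Strategist simulation of the gate's rendering of
`route edit --split PositiveMemory --into ConductanceLowerBound BulkBackflowFloor --glue-by …`:
the two child decls exactly as they will be written (one-line statements of children.json) and the
glue theorem shape `…GlueBy_holds : ConductanceLowerBound → BulkBackflowFloor → PositiveMemory := <decl>`. -/

namespace Summit.AtomisticToContinuum.FouriersLaw.Theses.HonestZwanzigSplitSim

open scoped BigOperators Topology Manifold Classical MeasureTheory ProbabilityTheory Matrix InnerProductSpace ComplexConjugate ContinuousMap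
open Filter Set Function TopologicalSpace MeasureTheory

def ConductanceLowerBound : Prop :=
  ∀ ω₂ lam β γ : ℝ, 0 < ω₂ → 0 < lam → 0 < β → 0 < γ → (∀ (N : ℕ) (T_L T_R : ℝ), 0 < T_L → 0 < T_R → ∀ μ ν : MeasureTheory.Measure (Literature.MathematicalPhysics.KineticTheory.HeatConduction.PhaseSpace N), (Literature.MathematicalPhysics.KineticTheory.HeatConduction.pinnedChain ω₂ lam β γ).IsSteadyState N T_L T_R μ → (Literature.MathematicalPhysics.KineticTheory.HeatConduction.pinnedChain ω₂ lam β γ).IsSteadyState N T_L T_R ν → μ = ν) → ∀ μ : (N : ℕ) → ℝ → ℝ → MeasureTheory.Measure (Literature.MathematicalPhysics.KineticTheory.HeatConduction.PhaseSpace N), (∀ (N : ℕ) (T_L T_R : ℝ), 0 < T_L → 0 < T_R → (Literature.MathematicalPhysics.KineticTheory.HeatConduction.pinnedChain ω₂ lam β γ).IsSteadyState N T_L T_R (μ N T_L T_R)) → ∀ T : ℝ, 0 < T → ∀ D : ℕ → ℝ, (∀ N : ℕ, Filter.Tendsto (fun δ : ℝ => (Literature.MathematicalPhysics.KineticTheory.HeatConduction.pinnedChain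 ω₂ lam β γ).totalCurrent (μ N (T + δ / 2) (T - δ / 2)) / δ) (nhdsWithin 0 {(0 : ℝ)}ᶜ) (nhds (D N))) → ∃ c : ℝ, 0 < c ∧ ∃ N₁ : ℕ, ∀ N : ℕ, N₁ ≤ N → c ≤ D N

def BulkBackflowFloor : Prop :=
  ∀ ω₂ lam β γ : ℝ, 0 < ω₂ → 0 < lam → 0 < β → 0 < γ → ∀ T : ℝ, 0 < T → ∀ δ : ℝ, 0 < δ → ∃ R : ℕ, ∀ N : ℕ, 2 ≤ N → let P := Literature.MathematicalPhysics.KineticTheory.HeatConduction.pinnedChain ω₂ lam β γ; let X := Literature.MathematicalPhysics.KineticTheory.HeatConduction.PhaseSpace N; let μ : MeasureTheory.Measure X := P.gibbsMeasure N T; let corr : (X → ℝ) → (X → ℝ) → ℝ → ℝ := fun f g t => (∫ z, f z * (∫ y, g y ∂(P.transitionKernel N T T t.toNNReal z)) ∂μ) - (∫ z, f z ∂μ) * (∫ z, g z ∂μ); let lap : ℝ → (X → ℝ) → (X → ℝ) → ℝ := fun s f g => ∫ t in Set.Ioi (0 : ℝ), Real.exp (-(s * t)) * corr f g t; let e : Fin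 N → X → ℝ := fun x z => z.2 x ^ 2 / 2 + P.U (z.1 x) + ∑ j : Fin N, ((if j.val = x.val + 1 then P.V (z.1 j - z.1 x) / 2 else 0) + (if x.val = j.val + 1 then P.V (z.1 x - z.1 j) / 2 else 0)); let G : ℝ → Matrix (Fin N) (Fin N) ℝ := fun s => Matrix.of fun x y => lap s (e x) (e y); let schur : ℝ → (X → ℝ) → (X → ℝ) → ℝ := fun s f g => lap s f g - ∑ x : Fin N, ∑ y : Fin N, lap s f (e x) * (G s)⁻¹ x y * lap s (e y) g; let J : X → ℝ := fun z => ∑ i : Fin N, P.bondCurrent N i z; ∀ b : Fin N, R ≤ b.val → b.val + 2 + R ≤ N → ∀ ρ ℓ : ℝ, Filter.Tendsto (fun s => schur s (P.bondCurrent N b) J) (nhdsWithin (0 : ℝ) (Set.Ioi 0)) (nhds ρ) → Filter.Tendsto (fun s => lap s (P.bondCurrent N b) J) (nhdsWithin (0 : ℝ) (Set.Ioi 0)) (nhds ℓ) → ℓ - δ ≤ ρ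

/-- glue-by candidate 1: the Cruxes workfile decl (k = 2). -/
theorem PositiveMemoryGlueBy_holds : ConductanceLowerBound → BulkBackflowFloor →
    Summit.AtomisticToContinuum.FouriersLaw.Theses.HonestZwanzig.PositiveMemory :=
  _root_.Summit.AtomisticToContinuum.FouriersLaw.Theorems.HonestZwanzig.PositiveMemory.PositiveMemory_of_backflowFloor

/-- glue-by candidate 2: the landed Theorems decl with the Kirchhoff-flatness antecedent discharged inline. -/
theorem PositiveMemoryGlue_term : ConductanceLowerBound → BulkBackflowFloor →
    Summit.AtomisticToContinuum.FouriersLaw.Theses.HonestZwanzig.PositiveMemory :=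
  fun h1 h2 => _root_.Summit.AtomisticToContinuum.FouriersLaw.Theorems.HonestZwanzig.PositiveMemory.stub_positiveMemory_of_backflowFloor
    (_root_.Summit.AtomisticToContinuum.FouriersLaw.Theorems.HonestZwanzig.PositiveMemory.stub_rowLimit
      _root_.Summit.AtomisticToContinuum.FouriersLaw.Theorems.HonestZwanzig.stub_feshbachIdentities) h1 h2

/-- dedup check: the child `ConductanceLowerBound` is the shared item stmt-AtomisticToContinuum-11749 verbatim. -/
example : ConductanceLowerBound = Summit.AtomisticToContinuum.FouriersLaw.Theses.JunctionLocality.ConductanceLowerBound := rfl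

/-- dedup check: the child `BulkBackflowFloor` is line Sketch's `BulkBackflowFloorSig` verbatim. -/
example : BulkBackflowFloor = Summit.AtomisticToContinuum.FouriersLaw.Theorems.HonestZwanzig.PositiveMemory.BulkBackflowFloorSig := rfl

end Summit.AtomisticToContinuum.FouriersLaw.Theses.HonestZwanzigSplitSim
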